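import Summits.KontsevichZagierPeriods.KontsevichZagierPeriods.Theorems.SymplecticScissorsPlanarCompiler

/-!
# `PlanarK0Injective` (crux stmt-KontsevichZagierPeriods-9847) — line `compiler-modus-ponens` (lead c1)

The compiler crux `PlanarCompiler` (stmt-10058) is PROVED (`PlanarCompilerProof.PlanarCompiler_proof`,
2026-08-16T09:42Z) and is literally `body(RealOnePeriodRelations) → body(PlanarK0Injective)`. So the crux
closes by ONE application from the existing item stmt-KontsevichZagierPeriods-10042; the single "stub"
below IS that item verbatim and is NOT to be seated or attacked here (it has its own lead and disprover).

Closing file when 10042 lands: `theorem PlanarK0Injective_proof : PlanarK0Injective :=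
PlanarCompiler_proof <10042's closing decl>` → `Theorems/SymplecticScissorsPlanarK0Injective.lean
--workitem stmt-KontsevichZagierPeriods-9847`.
-/

namespace Summit.KontsevichZagierPeriods.SymplecticScissors.PlanarK0InjectiveLine

open Summit.KontsevichZagierPeriods.KontsevichZagierPeriods.Theses.SymplecticScissors
open Summit.KontsevichZagierPeriods.SymplecticScissors.PlanarCompilerProof

/-- The one open input: item stmt-KontsevichZagierPeriods-10042 (`RealOnePeriodRelations`) verbatim —
Huber–Wüstholz Thm 13.3 (2) in real clothes; its own line (nash-retraction-thin-strip) is complete modulo the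
apex stmt-14055. [cite: HuberWustholz2022, Thm 13.3 (2)] -/
theorem stub_realOnePeriodRelations : RealOnePeriodRelations := by
  sorry

/-- **Composition.** The crux BY NAME from the one stub, by the proved compiler. [Kontsevich–Zagier 2001, §1.2] -/
theorem PlanarK0Injective_of : PlanarK0Injective :=
  PlanarCompiler_proof stub_realOnePeriodRelations

end Summit.KontsevichZagierPeriods.SymplecticScissors.PlanarK0InjectiveLine
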